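import Mathlib.Analysis.InnerProductSpace.PiL2
import Mathlib.Algebra.Order.Round
import Mathlib.Data.Fintype.BigOperators
import HarnessLib

/-!
# Finite `ε`-nets of the Euclidean unit ball with an explicit cardinality bound

Topic `Analysis/Convexity`. A fully PROVED, Mathlib-only quantitative covering lemma for the closed
unit ball of a finite-dimensional real inner product space `V`, `n = dim V`: for every `ε > 0` there
is a finite set `A` of vectors of norm `≤ 1` with `#A ≤ (√n/ε + 2)ⁿ` such that every vector of norm
`≤ 1` lies within distance `ε` of `A` (`exists_net_closedBall`). This is the net used by
Micciancio–Regev (*Worst-case to average-case reductions based on Gaussian measures*, SIAM J.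
Comput. 37 (2007), proof of Lemma 5.20, App. A p. 33 of the authors' version) and Aharonov–Regev
(J. ACM 52 (2005), Lemma 6.2) to bound the largest eigenvalue of a random matrix `W Wᵀ` by a union
bound over the net; the probabilistic statement is `Literature/Probability/Moments/
RandomMatrixLargestEigenvalue.lean`. Written for the decomposition of MR07 Thm. 5.23
(`Literature.Computability.Cryptography.MicciancioRegev2007_gapCVP'_to_SIS'`, test (c) of its
verifier), but independent of lattices.

## Construction and proof

MR07 partition the cube `[-1, 1]ⁿ ⊇ Sⁿ⁻¹` into `(2√n/ε)ⁿ` cubes of edge `ε/√n` (diameter `ε`) and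
pick a point of the sphere in each cube meeting it (tacitly assuming `2√n/ε ∈ ℕ`). Here: fix an
orthonormal basis `b` (`stdOrthonormalBasis`); for `x` with `‖x‖ ≤ 1` round each coordinate
`⟨bⱼ, x⟩` to the nearest point of the grid `hℤ`, `h = 2ε/√n` (coordinate error `≤ h/2`, so total
error `≤ √n h/2 = ε`, Parseval `OrthonormalBasis.sum_sq_inner_right`); the rounded point may leave
the unit ball, so it is projected back radially, which does not increase the distance to `x`
(`norm_inv_norm_smul_sub_le`: `‖x/‖x‖ - y‖ ≤ ‖x - y‖` for `‖x‖ > 1 ≥ ‖y‖`). The net is the image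
of the integer box `[-M, M]ⁿ`, `M = ⌊1/h + 1/2⌋`, so `#A ≤ (2M + 1)ⁿ ≤ (2/h + 2)ⁿ = (√n/ε + 2)ⁿ`.
With `ε = 1/(2K²)` this is `(2K²√n + 2)ⁿ ≤ (4K²√n)ⁿ = (2√n/ε)ⁿ` as soon as `K²√n ≥ 1`, which is
MR07's count.

Mathlib has covering and packing numbers (`Mathlib.Topology.MetricSpace.CoveringNumbers`) but, at
the time of writing, no cardinality bound for nets of the Euclidean ball (searched: `coveringNumber`,
`IsCover`, `net`); nothing here duplicates it.

## References

* D. Micciancio, O. Regev, *Worst-case to average-case reductions based on Gaussian measures*,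
  SIAM J. Comput. 37 (2007) 267–302; authors' version, Lemma 5.20 and App. A (p. 33)
  (`lit read doi:10.1137/S0097539705447360`).
* D. Aharonov, O. Regev, *Lattice problems in NP ∩ coNP*, J. ACM 52 (2005) 749–765, Lemma 6.2
  (Claim 2.8 for the net).
-/

noncomputable section

open Finset Metric Module
open scoped InnerProductSpace RealInnerProductSpace

namespace Literature.Analysis.Convexity

section Net

variable {V : Type*} [NormedAddCommGroup V] [InnerProductSpace ℝ V]

/-- Radial projection onto the unit ball does not increase distances to points of the ball: for
`‖x‖ > 1` and `‖y‖ ≤ 1`, `‖x/‖x‖ - y‖ ≤ ‖x - y‖` (as `‖x - y‖² - ‖x/‖x‖ - y‖² ≥ (‖x‖ - 1)²`).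
[folklore] -/
theorem norm_inv_norm_smul_sub_le {x y : V} (hx : 1 < ‖x‖) (hy : ‖y‖ ≤ 1) :
    ‖‖x‖⁻¹ • x - y‖ ≤ ‖x - y‖ := by
  set r := ‖x‖ with hr
  have hr0 : 0 < r := by linarith
  have hunit : ‖r⁻¹ • x‖ = 1 := by
    rw [norm_smul, norm_inv, norm_norm, ← hr, inv_mul_cancel₀ hr0.ne']
  have hxy : ⟪x, y⟫ ≤ r := by
    calc ⟪x, y⟫ ≤ ‖x‖ * ‖y‖ := real_inner_le_norm x y
      _ ≤ r * 1 := by rw [← hr]; gcongr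
      _ = r := mul_one r
  have h1 : ‖r⁻¹ • x - y‖ ^ 2 = 1 - 2 * (r⁻¹ * ⟪x, y⟫) + ‖y‖ ^ 2 := by
    rw [norm_sub_sq_real, hunit, real_inner_smul_left, one_pow]
  have h2 : ‖x - y‖ ^ 2 = r ^ 2 - 2 * ⟪x, y⟫ + ‖y‖ ^ 2 := by
    rw [norm_sub_sq_real, ← hr]
  have hdiff : ‖r⁻¹ • x - y‖ ^ 2 ≤ ‖x - y‖ ^ 2 := by
    rw [h1, h2]
    have hinv : r⁻¹ * r = 1 := inv_mul_cancel₀ hr0.ne'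
    have hle : (1 - r⁻¹) * ⟪x, y⟫ ≤ (1 - r⁻¹) * r := by
      apply mul_le_mul_of_nonneg_left hxy
      rw [sub_nonneg]
      exact inv_le_one_of_one_le₀ hx.le
    nlinarith
  exact (sq_le_sq₀ (norm_nonneg _) (norm_nonneg _)).1 hdiff

/-- **An `ε`-net of the unit ball of size `≤ (√n/ε + 2)ⁿ`** (the net of Micciancio–Regev 2007,
proof of Lemma 5.20, App. A p. 33, which partitions the cube `[-1, 1]ⁿ` into small cubes of
diameter `ε`): for `ε > 0` and `n = dim V ≥ 1` there is a finite set `A` of vectors of norm `≤ 1`,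
`#A ≤ (√n/ε + 2)ⁿ`, such that every vector of norm `≤ 1` is within distance `ε` of some point of
`A`. Construction: round the coordinates in an orthonormal basis to the grid of mesh `2ε/√n`
(error `≤ ε`), then project radially onto the unit ball (`norm_inv_norm_smul_sub_le`).
[cite: MicciancioRegev2007, Lemma 5.20 (proof, App. A p. 33) — variant] -/
theorem exists_net_closedBall [FiniteDimensional ℝ V] {ε : ℝ} (hε : 0 < ε) (hn : 0 < finrank ℝ V) :
    ∃ A : Finset V, (∀ u ∈ A, ‖u‖ ≤ 1) ∧
      ((A.card : ℝ) ≤ (Real.sqrt (finrank ℝ V) / ε + 2) ^ finrank ℝ V) ∧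
      ∀ x : V, ‖x‖ ≤ 1 → ∃ u ∈ A, ‖u - x‖ ≤ ε := by
  classical
  set n := finrank ℝ V
  set b : OrthonormalBasis (Fin n) ℝ V := stdOrthonormalBasis ℝ V
  have hsn : 0 < Real.sqrt n := Real.sqrt_pos.2 (by exact_mod_cast hn)
  -- mesh, coordinate range, grid points, projection
  set h : ℝ := 2 * ε / Real.sqrt n with hh
  have hh0 : 0 < h := by positivity
  set M : ℕ := ⌊1 / h + 1 / 2⌋₊ with hM
  set grid : (Fin n → ℤ) → V := fun k => ∑ j, ((k j : ℝ) * h) • b j with hgrid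
  set proj : V → V := fun x => if ‖x‖ ≤ 1 then x else ‖x‖⁻¹ • x with hproj
  have hproj1 : ∀ x, ‖proj x‖ ≤ 1 := fun x => by
    simp only [hproj]
    split_ifs with hx
    · exact hx
    · push Not at hx
      rw [norm_smul, norm_inv, norm_norm, inv_mul_cancel₀ (by linarith)]
  have hproj2 : ∀ x y : V, ‖y‖ ≤ 1 → ‖proj x - y‖ ≤ ‖x - y‖ := fun x y hy => by
    simp only [hproj]
    split_ifs with hx
    · exact le_rfl
    · exact norm_inv_norm_smul_sub_le (not_le.1 hx) hy
  have hinner : ∀ (k : Fin n → ℤ) (i : Fin n), ⟪b i, grid k⟫ = (k i : ℝ) * h := fun k i =>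
    b.orthonormal.inner_right_fintype _ _
  set K : Finset (Fin n → ℤ) := Fintype.piFinset fun _ : Fin n => Finset.Icc (-(M : ℤ)) M with hK
  refine ⟨K.image fun k => proj (grid k), ?_, ?_, ?_⟩
  · intro u hu
    obtain ⟨k, -, rfl⟩ := Finset.mem_image.1 hu
    exact hproj1 _
  · -- `#A ≤ (2M + 1)ⁿ ≤ (2/h + 2)ⁿ = (√n/ε + 2)ⁿ`
    have hcard : (K.image fun k => proj (grid k)).card ≤ (2 * M + 1) ^ n := by
      refine Finset.card_image_le.trans ?_
      rw [hK, Fintype.card_piFinset, Finset.prod_const, Finset.card_univ, Fintype.card_fin]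
      gcongr
      rw [Int.card_Icc]
      omega
    calc ((K.image fun k => proj (grid k)).card : ℝ) ≤ ((2 * M + 1) ^ n : ℕ) := by exact_mod_cast hcard
      _ ≤ (Real.sqrt n / ε + 2) ^ n := by
          push_cast
          refine pow_le_pow_left₀ (by positivity) ?_ n
          have hfl : (M : ℝ) ≤ 1 / h + 1 / 2 := Nat.floor_le (by positivity)
          have h1 : 1 / h = Real.sqrt n / (2 * ε) := by rw [hh]; field_simp
          have h2 : 2 * (Real.sqrt ↑n / (2 * ε)) = Real.sqrt n / ε := by field_simp
          linarith
  · -- rounding: `kⱼ = round(⟨bⱼ, x⟩/h)`, coordinate error `≤ h/2`, total error `≤ √n h/2 = ε`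
    intro x hx
    set k : Fin n → ℤ := fun j => round (⟪b j, x⟫ / h) with hk
    have hkK : k ∈ K := by
      rw [hK, Fintype.mem_piFinset]
      intro j
      have hcoord : |⟪b j, x⟫| ≤ 1 := by
        calc |⟪b j, x⟫| ≤ ‖b j‖ * ‖x‖ := abs_real_inner_le_norm _ _
          _ ≤ 1 * 1 := by gcongr; exact (b.orthonormal.norm_eq_one j).le
          _ = 1 := one_mul 1
      have habs : |(k j : ℝ)| ≤ 1 / h + 1 / 2 := by
        have h1 : |⟪b j, x⟫ / h| ≤ 1 / h := by
          rw [abs_div, abs_of_pos hh0]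
          exact div_le_div_of_nonneg_right hcoord hh0.le
        have h2 := abs_sub_round (⟪b j, x⟫ / h)
        calc |(k j : ℝ)| = |⟪b j, x⟫ / h - (⟪b j, x⟫ / h - round (⟪b j, x⟫ / h))| := by
              simp [hk]
          _ ≤ |⟪b j, x⟫ / h| + |⟪b j, x⟫ / h - round (⟪b j, x⟫ / h)| := abs_sub _ _
          _ ≤ 1 / h + 1 / 2 := add_le_add h1 h2
      have hnat : (k j).natAbs ≤ M := by
        apply Nat.le_floor
        rw [Nat.cast_natAbs, Int.cast_abs]
        exact habs
      rw [Finset.mem_Icc]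
      omega
    refine ⟨proj (grid k), Finset.mem_image.2 ⟨k, hkK, rfl⟩, (hproj2 _ _ hx).trans ?_⟩
    have hsq : ‖grid k - x‖ ^ 2 ≤ (Real.sqrt n * h / 2) ^ 2 := by
      rw [← b.sum_sq_inner_right]
      calc ∑ i, ⟪b i, grid k - x⟫ ^ 2 ≤ ∑ _i : Fin n, (h / 2) ^ 2 := by
            refine Finset.sum_le_sum fun i _ => ?_
            rw [inner_sub_right, hinner]
            have hr : |(k i : ℝ) * h - ⟪b i, x⟫| ≤ h / 2 := by
              have := abs_sub_round (⟪b i, x⟫ / h)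
              have heq : (k i : ℝ) * h - ⟪b i, x⟫ = -(h * (⟪b i, x⟫ / h - round (⟪b i, x⟫ / h))) := by
                simp only [hk]; field_simp; ring
              rw [heq, abs_neg, abs_mul, abs_of_pos hh0]
              calc h * |⟪b i, x⟫ / h - ↑(round (⟪b i, x⟫ / h))| ≤ h * (1 / 2) :=
                    mul_le_mul_of_nonneg_left this hh0.le
                _ = h / 2 := by ring
            exact sq_le_sq' (by linarith [abs_le.1 hr]) (abs_le.1 hr).2
        _ = (Real.sqrt n * h / 2) ^ 2 := by
            rw [Finset.sum_const, Finset.card_univ, Fintype.card_fin, nsmul_eq_mul,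
              show Real.sqrt n * h / 2 = Real.sqrt n * (h / 2) by ring, mul_pow,
              Real.sq_sqrt (Nat.cast_nonneg n)]
    have := (sq_le_sq₀ (norm_nonneg _) (by positivity)).1 hsq
    refine this.trans (le_of_eq ?_)
    rw [hh]; field_simp

/-- **The count of Micciancio–Regev 2007, App. A**: with `ε = 1/(2K²)` and `K²√n ≥ 1` the net of
`exists_net_closedBall` has at most `(√n/ε + 2)ⁿ = (2K²√n + 2)ⁿ ≤ (4√n K²)ⁿ = (2√n/ε)ⁿ` points,
the printed bound. [cite: MicciancioRegev2007, Lemma 5.20 (proof, App. A p. 33)] -/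
theorem exists_net_closedBall_card_le [FiniteDimensional ℝ V] {K : ℝ} (hK : 0 < K)
    (hn : 0 < finrank ℝ V) (hKn : 1 ≤ K ^ 2 * Real.sqrt (finrank ℝ V)) :
    ∃ A : Finset V, (∀ u ∈ A, ‖u‖ ≤ 1) ∧
      ((A.card : ℝ) ≤ (4 * Real.sqrt (finrank ℝ V) * K ^ 2) ^ finrank ℝ V) ∧
      ∀ x : V, ‖x‖ ≤ 1 → ∃ u ∈ A, ‖u - x‖ ≤ 1 / (2 * K ^ 2) := by
  obtain ⟨A, hA1, hAcard, hAnet⟩ :=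
    exists_net_closedBall (V := V) (by positivity : (0 : ℝ) < 1 / (2 * K ^ 2)) hn
  refine ⟨A, hA1, hAcard.trans ?_, hAnet⟩
  refine pow_le_pow_left₀ (by positivity) ?_ _
  have : Real.sqrt (finrank ℝ V) / (1 / (2 * K ^ 2)) = 2 * K ^ 2 * Real.sqrt (finrank ℝ V) := by
    field_simp
  rw [this]
  nlinarith

end Net

end Literature.Analysis.Convexity

end
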